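import Summits.FinalStateConjecture.FinalStateConjecture.Theses.EternalPapapetrou
import Literature.Geometry.Lorentzian.TameGenericityLocal
import Literature.Geometry.Lorentzian.TameGenericityDiagonal

/-!
# Crux `GenericCensoredCapture` — line `birth`: BIRTH SKELETON (BC3; skeleton registrar, 2026-08-17)

Crux item `stmt-FinalStateConjecture-17308`, decl (FIXED, concluded BY NAME in
`GenericCensoredCapture_of` / `GenericCensoredCapture_proof`):
`Summit.FinalStateConjecture.FinalStateConjecture.Theses.EternalPapapetrou.GenericCensoredCapture`
(route `route-FinalStateConjecture-EternalPapapetrou`, rev 10, crux rank 6) — the route's imported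
GENERIC SIDE `G`: for every data manifold `X`, tame-Christodoulou-generically in the admissible class
(codimension `1`, witness curves on ONE fixed end), an MGHD exists and every MGHD has complete `𝓘⁺`
and every HONEST `C⁰` final-state decomposition `d₀` of its self-determined exterior
(`O = exteriorOf d₀.charted`, `RaysStayInClosure`, `HasExhaustiveCharts`, `IsFutureOriented`)
upgrades to an honest `C²` one all of whose holes are sub-extremal. `G` is ONE generic statement
because curve-genericity is not closed under `∧` (the route docstring; card
genericity-is-not-closed-under-and); its informal text names three ingredients — weak cosmic
censorship in the Statement's typing, generic sub-extremality of final holes (third law as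
transversality), and the red-shift regularity upgrade `C⁰ ⇒ C²` for sub-extremal near zones.

## The cut — "censorship by curves, third law by strata, regularity pointwise"

Write, for an admissible datum `D`: `Cens D` (every MGHD has complete `𝓘⁺`), `Sub D` (every honest
`C⁰` decomposition of every MGHD has only sub-extremal holes `|aᵢ| < Mᵢ`), `Good D := ∀ MGHD,
complete 𝓘⁺ ∧ (honest C⁰ ⇒ sub-extremal)` (`= Cens ∧ Sub` read per development; verbatim the
property of the sibling item `GlobalAttraction.GenericCensorshipThirdLaw`, stmt-17297), and `P_G D`
for the crux's property. Pointwise on admissible data,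
`MGHD-existence ∧ Good D ∧ (C⁰ ⇒ C² upgrade under sub-extremality) ⇒ P_G D`,
so by locality of tame genericity in the parameter (`isTameChristodoulouGeneric_of_local`, landed)
the crux reduces to a LOCALLY GOOD tame immersed injective admissible curve through every
`P_G`-exceptional datum `D`. Such a `D` is (excluded middle) either

* VIOLATING (`¬ Cens D`: some MGHD has incomplete `𝓘⁺`) — tame weak cosmic censorship hands a
  CENSORED curve through `D` (its genericity witness), and the censored curve is STEERED into the
  good set (`stub_censoredLanding`: the holes formed along a censoring escape are strictly
  sub-extremal for small parameters — the escape can be tilted off the extremal threshold while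
  staying censored); or
* on the censored THRESHOLD (`Cens D ∧ ¬ Sub D`: censored, yet some MGHD carries an honest `C⁰`
  final state with an exactly extremal hole `|aᵢ| = Mᵢ`) — left along one tame curve by the
  generic third law / extremal-critical-collapse transversality (`stub_thresholdTransversal`,
  Kehle–Unger);

and along the good curve the members are upgraded to `P_G` by MGHD existence (`stub_mghdExists`,
Choquet-Bruhat–Geroch) and the pointwise red-shift upgrade (`stub_subextremalUpgrade`, verbatim the
sibling item `GlobalAttraction.SubextremalUpgrade`, stmt-17298). Five named stubs, each a classical
statement in its own right; two of them (`stub_mghdExists`, `stub_weakCosmicCensorship`) are SHARED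
verbatim with registered skeletons of sibling cruxes (`GenericCensoredHolesSettle/Lines/birth.lean`,
`TameCensorshipCollarMargin/Lines/birth.lean`) and with route items (`MGHDExists` stmt-9981/9937,
`PhaseMixingCapture.WeakCosmicCensorshipTame` stmt-17269 up to its anti-vacuity conjunct), and one
(`stub_subextremalUpgrade`) with the item stmt-17298 — so that closing those closes these.

Composition `GenericCensoredCapture_of` (kernel-checked, no `sorry` of its own, ~40 lines): locality,
the pointwise key, `by_cases Cens D`, threshold ⇒ (key, contraposed) an extremal honest `C⁰` final
state exists ⇒ Stub 3; violating ⇒ Stub 1's witness curve is censored off `0` ⇒ Stub 2 lands; members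
upgraded by the key (Stubs 0, 4). The seam is a case analysis over two physically distinct strata plus
the tree's locality theorem and a pointwise regularity implication — not `exact ⟨h₁, h₂⟩`.

Logical position (§4, sorry-free): Stubs 1–3 ⇒ the sibling crux `GenericCensorshipThirdLaw`
(restated here as `TameCensorshipThirdLaw`) ⇒ Stubs 1–3 back (weakenings), i.e. Stubs 1–3 are an
honest decomposition of stmt-17297 too; and `MGHDExists → TameCensorshipThirdLaw →
SubextremalUpgrade → GenericCensoredCapture` (monotonicity), recording that this crux is implied by
three items of route GlobalAttraction. The crux implies Stub 1 (mono). No stub alone is the crux or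
the summit: Stub 0 is MGHD existence, Stub 1 says nothing about black holes, Stub 2 produces nothing
without a censored curve through a violating datum, Stub 3 never meets a violating datum, Stub 4 is a
pointwise regularity statement with no genericity in it.

## BC3 probes (seat folder `bc/GenericCensoredCapture_probe_<k>{a,b}.lean`; they import the route
## file only — NOT this skeleton — so no sorried theorem concluding the crux is in scope)
For each stub `S` (signature restated verbatim as a `def`): `S → GenericCensoredCapture` and
`S → FinalStateConjecture` by `first | exact? | simpa [S] | (unfold S; simpa) | aesop`
(400 000 heartbeats): all ten FAIL (log in `Lines/birth.md`).

## Disproof used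
None relevant: the crux has no `Disproof.lean` / `Negative/` lemma (`ledger crux ls
stmt-FinalStateConjecture-17308`: no workfiles before this one); `ledger negatives --problem
FinalStateConjecture` lists one unrelated refutation (`not_UniformPhotonSphereChannels`, item 10045,
a Regge–Wheeler channel estimate). No stub is an instance of it. All stubs are typed over the T2
re-typed notions only (tame genericity on one fixed end — no burial witnesses; honest radii;
`RaysStayInClosure`; `IsFutureOriented`).
-/

noncomputable section

-- D-0017: single-problem summit, `Summit.<S>.<S>.…` by design (cf. lakefile `weak.linter.dupNamespace`).
set_option linter.dupNamespace false

namespace Summit.FinalStateConjecture.FinalStateConjecture.Cruxes.GenericCensoredCapture.Birth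

open Set Filter Function Topology TopologicalSpace
open scoped Manifold ContDiff Classical
open Literature.Geometry.Lorentzian
open Summit.FinalStateConjecture.FinalStateConjecture.Theses.EternalPapapetrou

/-! ## §0 Vocabulary (readability only: used in the named statements and the composition; NO stub
signature mentions it — the stubs are stated EXPANDED over Statement + Literature declarations) -/

section Vocabulary

variable {X : Type} [TopologicalSpace X] [ChartedSpace E3 X] [IsManifold (𝓡 3) ∞ X]
  [ConnectedSpace X]

/-- **`D` is censored**: every MGHD of `D` has complete future null infinity (sojourn form).
[cite: Christodoulou1999, pp. A26–A27] -/
abbrev IsCensored (D : InitialDataSet (𝓡 3) X) : Prop :=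
  ∀ 𝒟 : VacuumCauchyDevelopment D, 𝒟.IsMaximal →
    Summit.FinalStateConjecture.HasCompleteNullInfinity 𝒟.toCauchyDevelopment

/-- **`D` is good (censored AND capturing sub-extremally)**: every MGHD of `D` has complete `𝓘⁺`
and every HONEST `C⁰` final-state decomposition of its self-determined exterior has only
sub-extremal holes `|aᵢ| < Mᵢ` — verbatim the tame-generic property of the sibling item
`GlobalAttraction.GenericCensorshipThirdLaw` (weak cosmic censorship conjoined ON THE SAME
exceptional set with "extremal black holes do not form generically"). [cite: DafermosLuk2017, Conjecture 1]
[cite: KehleUnger2025] -/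
abbrev IsGood (D : InitialDataSet (𝓡 3) X) : Prop :=
  ∀ 𝒟 : VacuumCauchyDevelopment D, 𝒟.IsMaximal →
    Summit.FinalStateConjecture.HasCompleteNullInfinity 𝒟.toCauchyDevelopment ∧
      ∀ (O : Set 𝒟.carrier) (d : FinalStateDecomposition 𝒟.toSpacetime O 0),
        O = Summit.FinalStateConjecture.exteriorOf 𝒟.toCauchyDevelopment d.charted →
          Summit.FinalStateConjecture.RaysStayInClosure 𝒟.toCauchyDevelopment O →
            Summit.FinalStateConjecture.HasExhaustiveCharts d →
              Summit.FinalStateConjecture.IsFutureOriented d →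
                ∀ i, Kerr.IsSubextremal (d.mass i) (d.spin i)

/-- **The crux's property of a datum** (`P_G`): an MGHD exists, and every MGHD has complete `𝓘⁺`
and upgrades every honest `C⁰` final-state decomposition of its exterior to an honest `C²` one with
sub-extremal holes — verbatim the lambda of `GenericCensoredCapture`. [cite: DafermosLuk2017, Conjecture 1] -/
abbrev CruxProperty (D : InitialDataSet (𝓡 3) X) : Prop :=
  (∃ 𝒟 : VacuumCauchyDevelopment D, 𝒟.IsMaximal) ∧
    ∀ 𝒟 : VacuumCauchyDevelopment D, 𝒟.IsMaximal →
      Summit.FinalStateConjecture.HasCompleteNullInfinity 𝒟.toCauchyDevelopment ∧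
        ∀ (O : Set 𝒟.carrier) (d₀ : FinalStateDecomposition 𝒟.toSpacetime O 0),
          O = Summit.FinalStateConjecture.exteriorOf 𝒟.toCauchyDevelopment d₀.charted →
            Summit.FinalStateConjecture.RaysStayInClosure 𝒟.toCauchyDevelopment O →
              Summit.FinalStateConjecture.HasExhaustiveCharts d₀ →
                Summit.FinalStateConjecture.IsFutureOriented d₀ →
                  ∃ (O' : Set 𝒟.carrier) (d : FinalStateDecomposition 𝒟.toSpacetime O' 2),
                    (∀ i, Kerr.IsSubextremal (d.mass i) (d.spin i)) ∧
                      O' = Summit.FinalStateConjecture.exteriorOf 𝒟.toCauchyDevelopment d.charted ∧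
                        Summit.FinalStateConjecture.RaysStayInClosure 𝒟.toCauchyDevelopment O' ∧
                          Summit.FinalStateConjecture.HasExhaustiveCharts d ∧
                            Summit.FinalStateConjecture.IsFutureOriented d

end Vocabulary

/-- Consistency: the crux IS tame genericity of `CruxProperty` (by `δ`/`β`). [folklore] -/
theorem genericCensoredCapture_iff :
    GenericCensoredCapture ↔
      ∀ (X : Type) [TopologicalSpace X] [ChartedSpace E3 X] [IsManifold (𝓡 3) ∞ X] [T2Space X]
        [SecondCountableTopology X] [ConnectedSpace X],
        InitialDataSet.IsTameChristodoulouGeneric (admissibleVacuumData X)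
          (fun D ↦ CruxProperty D) 1 :=
  Iff.rfl

/-! ## §1 The five statements of the line (named; nothing here is a route item of THIS route except
that `AdmissibleMGHDExistence` is verbatim the support item `MGHDExists`) -/

/-- **MGHD EXISTENCE for admissible data** (`stub_mghdExists`): every datum of Christodoulou's
admissible class on every connected Hausdorff second-countable `3`-manifold has a maximal vacuum
Cauchy development (repaired structure `VacuumCauchyDevelopment`, `IsMaximal`). Choquet-Bruhat–Geroch,
CMP 14 (1969), Thm. 3 (p. 332); Sbierski, AHP 17 (2016) = arXiv:1309.7591, Thm. 2.8. KNOWN in print;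
verbatim the route's support item `MGHDExists` (stmt-FinalStateConjecture-9981) and the sibling
items/stubs of the same name; in the tree the unproved named fact
`choquetBruhat_geroch_exists_mghd_cauchy`. Why it might fail (as a tree statement): `IsMaximal` asks
EVERY typed vacuum Cauchy development of `D` (carrier in `Type`) to embed into one `𝒟`; a typing
defect of the repaired prelude, not the mathematics, is the risk.
[cite: ChoquetBruhatGeroch1969CMP, Thm. 3 (p. 332)] -/
def AdmissibleMGHDExistence : Prop :=
  ∀ (X : Type) [TopologicalSpace X] [ChartedSpace E3 X] [IsManifold (𝓡 3) ∞ X] [T2Space X]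
    [SecondCountableTopology X] [ConnectedSpace X],
    ∀ D ∈ admissibleVacuumData X, ∃ 𝒟 : VacuumCauchyDevelopment D, 𝒟.IsMaximal

/-- **TAME WEAK COSMIC CENSORSHIP** (`stub_weakCosmicCensorship`): for every connected Hausdorff
second-countable `3`-manifold `X`, tame-generically in the admissible class (Christodoulou
codimension `1`; witness curves on ONE fixed asymptotically flat end, `wDist`-continuous and
immersed at `0`), every MGHD has complete future null infinity. Christodoulou, CQG 16 (1999) A23,
p. A24 (proved for the spherically symmetric scalar field, Ann. Math. 149 (1999) 183, p. 187); open
in vacuum without symmetry. Verbatim the registered stubs `stub_weakCosmicCensorship`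
(`GenericCensoredHolesSettle/Lines/birth.lean`) and `stub_tameCensorship`
(`TameCensorshipCollarMargin/Lines/birth.lean`). Why it might fail: the exterior-naked-singularity
vacuum solutions of Rodnianski–Shlapentokh-Rothman (arXiv:1912.08478) might be stable under
admissible perturbations at FIXED asymptotics (tameness forbids censoring by a far-out giant hole);
trapped-surface-formation instability is known only in symmetry / for the scalar field.
[cite: Christodoulou1999, p. A24] [cite: arXiv08110354, §2.6.2] -/
def TameWeakCosmicCensorship : Prop :=
  ∀ (X : Type) [TopologicalSpace X] [ChartedSpace E3 X] [IsManifold (𝓡 3) ∞ X] [T2Space X]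
    [SecondCountableTopology X] [ConnectedSpace X],
    InitialDataSet.IsTameChristodoulouGeneric (admissibleVacuumData X) (fun D ↦ IsCensored D) 1

/-- **LANDING OFF THE THRESHOLD ALONG CENSORED CURVES, local in the parameter**
(`stub_censoredLanding`): for every end `e` and every tame (on `e`), immersed-at-`0`, injective curve
`F` of admissible data whose base datum `F 0` has an MGHD with INCOMPLETE `𝓘⁺` and whose members off
`0` are censored (this is what tame weak cosmic censorship hands over), there are an end `e'`, a tame
immersed injective curve `F'` of admissible data with `F' 0 = F 0`, and `ε > 0` such that every member
`F' c`, `0 < ‖c‖ < ε`, is GOOD: every MGHD censored AND every honest `C⁰` final-state decomposition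
of its exterior (`O = exteriorOf`, `RaysStayInClosure`, exhaustive future-oriented charts) has only
sub-extremal holes. Content: the censoring escape from a naked-singularity datum can be tilted off the
extremal threshold while staying censored — black holes formed by trapped-surface-forming perturbations
of a censorship-violating datum are strictly sub-extremal for small parameter (third law along ONE
curve; no settling and no regularity is claimed here). Why it might fail: every censoring curve
through a violating datum might be forced to run inside the extremal threshold (extremal holes forming
all along the escape, cf. extremal critical collapse, Kehle–Unger arXiv:2402.10190), or censorship
might be lost under every tilt (complete `𝓘⁺` is not known to be stable off Kerr).
[cite: Christodoulou1999, p. A24] [cite: KehleUnger2025] [cite: DafermosLuk2017, Conjecture 1] -/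
def CensoredLanding : Prop :=
  ∀ (X : Type) [TopologicalSpace X] [ChartedSpace E3 X] [IsManifold (𝓡 3) ∞ X] [T2Space X]
    [SecondCountableTopology X] [ConnectedSpace X],
    ∀ (e : AFEnd X) (F : EuclideanSpace ℝ (Fin 1) → InitialDataSet (𝓡 3) X),
      InitialDataSet.IsTameDataFamily e 1 F → InitialDataSet.IsImmersedAtZero 1 F → Injective F →
        (∀ c, F c ∈ admissibleVacuumData X) →
          (∃ 𝒟 : VacuumCauchyDevelopment (F 0), 𝒟.IsMaximal ∧
              ¬ Summit.FinalStateConjecture.HasCompleteNullInfinity 𝒟.toCauchyDevelopment) →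
            (∀ c ≠ 0, IsCensored (F c)) →
              ∃ (e' : AFEnd X) (F' : EuclideanSpace ℝ (Fin 1) → InitialDataSet (𝓡 3) X),
                InitialDataSet.IsTameDataFamily e' 1 F' ∧ InitialDataSet.IsImmersedAtZero 1 F' ∧
                  F' 0 = F 0 ∧ Injective F' ∧ (∀ c, F' c ∈ admissibleVacuumData X) ∧
                    ∃ ε > (0 : ℝ), ∀ c, c ≠ 0 → ‖c‖ < ε → IsGood (F' c)

/-- **TRANSVERSALITY OF THE CENSORED EXTREMAL THRESHOLD, local in the parameter**
(`stub_thresholdTransversal`): through every admissible datum `D` all of whose MGHDs have complete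
`𝓘⁺` but one of which carries an HONEST `C⁰` final-state decomposition (`O = exteriorOf`,
`RaysStayInClosure`, `HasExhaustiveCharts`, `IsFutureOriented`) with a hole that is NOT sub-extremal
(hence exactly extremal, `|aᵢ| = Mᵢ`) pass one end `e`, a tame immersed injective curve `F` of
admissible data with `F 0 = D`, and `ε > 0` such that every member `F c`, `0 < ‖c‖ < ε`, is good
(censored, all honest `C⁰` final holes sub-extremal). Content: the generic third law of black-hole
mechanics as TRANSVERSALITY — the data settling (in `C⁰`, honestly) to a configuration containing an
extremal Kerr form a stratum of positive TAME codimension inside the censored data, crossed by one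
tame curve (extremal critical collapse is a codimension-one threshold phenomenon: Kehle–Unger,
arXiv:2402.10190, arXiv:2211.15742; vacuum: conjectural), and censorship persists along the crossing.
Why it might fail: the extremal threshold of vacuum collapse need not be tame (one-sided or Cantor
accumulation of extremal end states along every admissible curve through `D`), extremal Kerr might
form from an OPEN set of admissible data (kills the summit itself), or every transversal curve could
lose censorship. [cite: KehleUnger2025] [cite: DafermosLuk2017, Conjecture 1] -/
def ThresholdTransversality : Prop :=
  ∀ (X : Type) [TopologicalSpace X] [ChartedSpace E3 X] [IsManifold (𝓡 3) ∞ X] [T2Space X]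
    [SecondCountableTopology X] [ConnectedSpace X],
    ∀ D ∈ admissibleVacuumData X, IsCensored D →
      (∃ 𝒟 : VacuumCauchyDevelopment D, 𝒟.IsMaximal ∧
          ∃ (O : Set 𝒟.carrier) (d₀ : FinalStateDecomposition 𝒟.toSpacetime O 0),
            O = Summit.FinalStateConjecture.exteriorOf 𝒟.toCauchyDevelopment d₀.charted ∧
              Summit.FinalStateConjecture.RaysStayInClosure 𝒟.toCauchyDevelopment O ∧
                Summit.FinalStateConjecture.HasExhaustiveCharts d₀ ∧
                  Summit.FinalStateConjecture.IsFutureOriented d₀ ∧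
                    ∃ i, ¬ Kerr.IsSubextremal (d₀.mass i) (d₀.spin i)) →
        ∃ (e : AFEnd X) (F : EuclideanSpace ℝ (Fin 1) → InitialDataSet (𝓡 3) X),
          InitialDataSet.IsTameDataFamily e 1 F ∧ InitialDataSet.IsImmersedAtZero 1 F ∧ F 0 = D ∧
            Injective F ∧ (∀ c, F c ∈ admissibleVacuumData X) ∧
              ∃ ε > (0 : ℝ), ∀ c, c ≠ 0 → ‖c‖ < ε → IsGood (F c)

/-- **THE RED-SHIFT REGULARITY UPGRADE `C⁰ ⇒ C²` FOR SUB-EXTREMAL NEAR ZONES, pointwise (all data)**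
(`stub_subextremalUpgrade`): for every admissible datum, every MGHD with complete `𝓘⁺`, and every
HONEST `C⁰` final-state decomposition `d₀` of its exterior all of whose holes are sub-extremal, some
region `O'` carries an honest `C²` final-state decomposition `d` with sub-extremal holes — verbatim the
sibling item `GlobalAttraction.SubextremalUpgrade` (stmt-FinalStateConjecture-17298; also
`TwoBoundarySqueeze.SubextremalUpgradeC2`). Content: an eternally `C⁰`-near-sub-extremal-Kerr vacuum
exterior with complete `𝓘⁺` converges in `C²` (eventual uniform red-shift `κ → κ_∞ > 0`, near-Kerr
nonlinear observability, horizon-normalised future-oriented charts; ray-closure inherited). No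
genericity in it. Why it might fail: `C⁰` closeness in SOME chart gives no curvature control — the `C²`
chart must be rebuilt from red-shift + smooth data, decay being known on the full range `|a| < M` only
linearly (arXiv:1402.7034, arXiv:2302.08916; nonlinear only `|a| ≪ M`, arXiv:2104.11857,
arXiv:2205.14808); a Burnett-type high-frequency tail (arXiv:2009.08968) would be `C⁰`- but not
`C²`-settled. [cite: KlainermanSzeftel2023] [cite: DafermosHolzegelRodnianskiTaylor2021]
[cite: arXiv08110354, §2.6.2] -/
def SubextremalRedshiftUpgrade : Prop :=
  ∀ (X : Type) [TopologicalSpace X] [ChartedSpace E3 X] [IsManifold (𝓡 3) ∞ X] [T2Space X]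
    [SecondCountableTopology X] [ConnectedSpace X],
    ∀ D ∈ admissibleVacuumData X, ∀ 𝒟 : VacuumCauchyDevelopment D, 𝒟.IsMaximal →
      Summit.FinalStateConjecture.HasCompleteNullInfinity 𝒟.toCauchyDevelopment →
        ∀ (O : Set 𝒟.carrier) (d₀ : FinalStateDecomposition 𝒟.toSpacetime O 0),
          O = Summit.FinalStateConjecture.exteriorOf 𝒟.toCauchyDevelopment d₀.charted →
            Summit.FinalStateConjecture.RaysStayInClosure 𝒟.toCauchyDevelopment O →
              Summit.FinalStateConjecture.HasExhaustiveCharts d₀ →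
                Summit.FinalStateConjecture.IsFutureOriented d₀ →
                  (∀ i, Kerr.IsSubextremal (d₀.mass i) (d₀.spin i)) →
                    ∃ (O' : Set 𝒟.carrier) (d : FinalStateDecomposition 𝒟.toSpacetime O' 2),
                      (∀ i, Kerr.IsSubextremal (d.mass i) (d.spin i)) ∧
                        O' = Summit.FinalStateConjecture.exteriorOf 𝒟.toCauchyDevelopment d.charted ∧
                          Summit.FinalStateConjecture.RaysStayInClosure 𝒟.toCauchyDevelopment O' ∧
                            Summit.FinalStateConjecture.HasExhaustiveCharts d ∧
                              Summit.FinalStateConjecture.IsFutureOriented d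

/-- **The sibling crux, restated**: tame genericity of `IsGood` — verbatim (up to the spelling of the
smoothness binder and bound-variable names) the item `GlobalAttraction.GenericCensorshipThirdLaw`
(stmt-FinalStateConjecture-17297; also `TwoBoundarySqueeze.GenericCensorshipThirdLaw`). Not a stub of
this line: it is what Stubs 1–3 assemble to (§4). [cite: Christodoulou1999, p. A24] [cite: KehleUnger2025] -/
def TameCensorshipThirdLaw : Prop :=
  ∀ (X : Type) [TopologicalSpace X] [ChartedSpace E3 X] [IsManifold (𝓡 3) ∞ X] [T2Space X]
    [SecondCountableTopology X] [ConnectedSpace X],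
    InitialDataSet.IsTameChristodoulouGeneric (admissibleVacuumData X) (fun D ↦ IsGood D) 1

/-! ### Statements of the registered stubs, under the stub names
The skeleton audit reads the hypotheses of `GenericCensoredCapture_of` BY NAME: each head is a
declared stub. -/
namespace Goal

/-- Statement of `stub_mghdExists`. -/
abbrev stub_mghdExists : Prop := AdmissibleMGHDExistence
/-- Statement of `stub_weakCosmicCensorship`. -/
abbrev stub_weakCosmicCensorship : Prop := TameWeakCosmicCensorship
/-- Statement of `stub_censoredLanding`. -/
abbrev stub_censoredLanding : Prop := CensoredLanding
/-- Statement of `stub_thresholdTransversal`. -/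
abbrev stub_thresholdTransversal : Prop := ThresholdTransversality
/-- Statement of `stub_subextremalUpgrade`. -/
abbrev stub_subextremalUpgrade : Prop := SubextremalRedshiftUpgrade

end Goal

/-! ## §2 Registered stubs (the five `sorry`s of the file), stated EXPANDED over existing declarations
(Statement + Literature prelude only, fully qualified; no vocabulary of this file occurs in a stub
signature, so each registered signature elaborates standalone in a Theorems file). -/

/-- **Stub 0** (known in print, XL as a formalisation): MGHD existence for admissible data — see
`AdmissibleMGHDExistence`; verbatim the route item `MGHDExists`. [cite: ChoquetBruhatGeroch1969CMP, Thm. 3 (p. 332)] -/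
theorem stub_mghdExists :
    ∀ (X : Type) [TopologicalSpace X] [ChartedSpace Literature.Geometry.Lorentzian.E3 X] [IsManifold (𝓡 3) (⊤ : ℕ∞) X] [T2Space X] [SecondCountableTopology X] [ConnectedSpace X], ∀ D ∈ Literature.Geometry.Lorentzian.admissibleVacuumData X, ∃ 𝒟 : Literature.Geometry.Lorentzian.VacuumCauchyDevelopment D, 𝒟.IsMaximal := by
  sorry

/-- **Stub 1** (XL, open-problem): tame weak cosmic censorship — see `TameWeakCosmicCensorship`.
[cite: Christodoulou1999, p. A24] -/
theorem stub_weakCosmicCensorship :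
    ∀ (X : Type) [TopologicalSpace X] [ChartedSpace Literature.Geometry.Lorentzian.E3 X] [IsManifold (𝓡 3) (⊤ : ℕ∞) X] [T2Space X] [SecondCountableTopology X] [ConnectedSpace X], Literature.Geometry.Lorentzian.InitialDataSet.IsTameChristodoulouGeneric (Literature.Geometry.Lorentzian.admissibleVacuumData X) (fun D ↦ ∀ 𝒟 : Literature.Geometry.Lorentzian.VacuumCauchyDevelopment D, 𝒟.IsMaximal → Summit.FinalStateConjecture.HasCompleteNullInfinity 𝒟.toCauchyDevelopment) 1 := by
  sorry

/-- **Stub 2** (L–XL, open-problem): landing off the threshold along censored curves, local in the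
parameter — see `CensoredLanding`. [cite: Christodoulou1999, p. A24] [cite: KehleUnger2025] -/
theorem stub_censoredLanding :
    ∀ (X : Type) [TopologicalSpace X] [ChartedSpace Literature.Geometry.Lorentzian.E3 X] [IsManifold (𝓡 3) (⊤ : ℕ∞) X] [T2Space X] [SecondCountableTopology X] [ConnectedSpace X], ∀ (e : Literature.Geometry.Lorentzian.AFEnd X) (F : EuclideanSpace ℝ (Fin 1) → Literature.Geometry.Lorentzian.InitialDataSet (𝓡 3) X), Literature.Geometry.Lorentzian.InitialDataSet.IsTameDataFamily e 1 F → Literature.Geometry.Lorentzian.InitialDataSet.IsImmersedAtZero 1 F → Function.Injective F → (∀ c, F c ∈ Literature.Geometry.Lorentzian.admissibleVacuumData X) → (∃ 𝒟 : Literature.Geometry.Lorentzian.VacuumCauchyDevelopment (F 0), 𝒟.IsMaximal ∧ ¬ Summit.FinalStateConjecture.HasCompleteNullInfinity 𝒟.toCauchyDevelopment) → (∀ c ≠ 0, ∀ 𝒟 : Literature.Geometry.Lorentzian.VacuumCauchyDevelopment (F c), 𝒟.IsMaximal → Summit.FinalStateConjecture.HasCompleteNullInfinity 𝒟.toCauchyDevelopment)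 → ∃ (e' : Literature.Geometry.Lorentzian.AFEnd X) (F' : EuclideanSpace ℝ (Fin 1) → Literature.Geometry.Lorentzian.InitialDataSet (𝓡 3) X), Literature.Geometry.Lorentzian.InitialDataSet.IsTameDataFamily e' 1 F' ∧ Literature.Geometry.Lorentzian.InitialDataSet.IsImmersedAtZero 1 F' ∧ F' 0 = F 0 ∧ Function.Injective F' ∧ (∀ c, F' c ∈ Literature.Geometry.Lorentzian.admissibleVacuumData X) ∧ ∃ ε > (0 : ℝ), ∀ c, c ≠ 0 → ‖c‖ < ε → ∀ 𝒟 : Literature.Geometry.Lorentzian.VacuumCauchyDevelopment (F' c), 𝒟.IsMaximal → Summit.FinalStateConjecture.HasCompleteNullInfinity 𝒟.toCauchyDevelopment ∧ ∀ (O : Set 𝒟.carrier) (d : Literature.Geometry.Lorentzian.FinalStateDecomposition 𝒟.toSpacetime O 0), O = Summit.FinalStateConjecture.exteriorOf 𝒟.toCauchyDevelopment d.charted → Summit.FinalStateConjecture.RaysStayInClosure 𝒟.toCauchyDevelopment O → Summit.FinalStateConjecture.HasExhaustiveCharts d → Summit.FinalStateConjecture.IsFutureOriented d → ∀ i, Literature.Geometry.Lorentzian.Kerr.IsSubextremal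 (d.mass i) (d.spin i) := by
  sorry

/-- **Stub 3** (XL, open-problem): transversality of the censored extremal threshold, local in the
parameter — see `ThresholdTransversality`. [cite: KehleUnger2025] [cite: DafermosLuk2017, Conjecture 1] -/
theorem stub_thresholdTransversal :
    ∀ (X : Type) [TopologicalSpace X] [ChartedSpace Literature.Geometry.Lorentzian.E3 X] [IsManifold (𝓡 3) (⊤ : ℕ∞) X] [T2Space X] [SecondCountableTopology X] [ConnectedSpace X], ∀ D ∈ Literature.Geometry.Lorentzian.admissibleVacuumData X, (∀ 𝒟 : Literature.Geometry.Lorentzian.VacuumCauchyDevelopment D, 𝒟.IsMaximal → Summit.FinalStateConjecture.HasCompleteNullInfinity 𝒟.toCauchyDevelopment) → (∃ 𝒟 : Literature.Geometry.Lorentzian.VacuumCauchyDevelopment D, 𝒟.IsMaximal ∧ ∃ (O : Set 𝒟.carrier) (d₀ : Literature.Geometry.Lorentzian.FinalStateDecomposition 𝒟.toSpacetime O 0), O = Summit.FinalStateConjecture.exteriorOf 𝒟.toCauchyDevelopment d₀.charted ∧ Summit.FinalStateConjecture.RaysStayInClosure 𝒟.toCauchyDevelopment O ∧ Summit.FinalStateConjecture.HasExhaustiveCharts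 d₀ ∧ Summit.FinalStateConjecture.IsFutureOriented d₀ ∧ ∃ i, ¬ Literature.Geometry.Lorentzian.Kerr.IsSubextremal (d₀.mass i) (d₀.spin i)) → ∃ (e : Literature.Geometry.Lorentzian.AFEnd X) (F : EuclideanSpace ℝ (Fin 1) → Literature.Geometry.Lorentzian.InitialDataSet (𝓡 3) X), Literature.Geometry.Lorentzian.InitialDataSet.IsTameDataFamily e 1 F ∧ Literature.Geometry.Lorentzian.InitialDataSet.IsImmersedAtZero 1 F ∧ F 0 = D ∧ Function.Injective F ∧ (∀ c, F c ∈ Literature.Geometry.Lorentzian.admissibleVacuumData X) ∧ ∃ ε > (0 : ℝ), ∀ c, c ≠ 0 → ‖c‖ < ε → ∀ 𝒟 : Literature.Geometry.Lorentzian.VacuumCauchyDevelopment (F c), 𝒟.IsMaximal → Summit.FinalStateConjecture.HasCompleteNullInfinity 𝒟.toCauchyDevelopment ∧ ∀ (O : Set 𝒟.carrier) (d : Literature.Geometry.Lorentzian.FinalStateDecomposition 𝒟.toSpacetime O 0), O = Summit.FinalStateConjecture.exteriorOf 𝒟.toCauchyDevelopment d.charted → Summit.FinalStateConjecture.RaysStayInClosure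 𝒟.toCauchyDevelopment O → Summit.FinalStateConjecture.HasExhaustiveCharts d → Summit.FinalStateConjecture.IsFutureOriented d → ∀ i, Literature.Geometry.Lorentzian.Kerr.IsSubextremal (d.mass i) (d.spin i) := by
  sorry

/-- **Stub 4** (XL, open-problem): the red-shift regularity upgrade `C⁰ ⇒ C²` under sub-extremality,
pointwise — see `SubextremalRedshiftUpgrade`; verbatim the sibling item `GlobalAttraction.SubextremalUpgrade`.
[cite: KlainermanSzeftel2023] [cite: DafermosHolzegelRodnianskiTaylor2021] -/
theorem stub_subextremalUpgrade :
    ∀ (X : Type) [TopologicalSpace X] [ChartedSpace Literature.Geometry.Lorentzian.E3 X] [IsManifold (𝓡 3) (⊤ : ℕ∞) X] [T2Space X] [SecondCountableTopology X] [ConnectedSpace X], ∀ D ∈ Literature.Geometry.Lorentzian.admissibleVacuumData X, ∀ 𝒟 : Literature.Geometry.Lorentzian.VacuumCauchyDevelopment D, 𝒟.IsMaximal → Summit.FinalStateConjecture.HasCompleteNullInfinity 𝒟.toCauchyDevelopment → ∀ (O : Set 𝒟.carrier) (d₀ : Literature.Geometry.Lorentzian.FinalStateDecomposition 𝒟.toSpacetime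 O 0), O = Summit.FinalStateConjecture.exteriorOf 𝒟.toCauchyDevelopment d₀.charted → Summit.FinalStateConjecture.RaysStayInClosure 𝒟.toCauchyDevelopment O → Summit.FinalStateConjecture.HasExhaustiveCharts d₀ → Summit.FinalStateConjecture.IsFutureOriented d₀ → (∀ i, Literature.Geometry.Lorentzian.Kerr.IsSubextremal (d₀.mass i) (d₀.spin i)) → ∃ (O' : Set 𝒟.carrier) (d : Literature.Geometry.Lorentzian.FinalStateDecomposition 𝒟.toSpacetime O' 2), (∀ i, Literature.Geometry.Lorentzian.Kerr.IsSubextremal (d.mass i) (d.spin i)) ∧ O' = Summit.FinalStateConjecture.exteriorOf 𝒟.toCauchyDevelopment d.charted ∧ Summit.FinalStateConjecture.RaysStayInClosure 𝒟.toCauchyDevelopment O' ∧ Summit.FinalStateConjecture.HasExhaustiveCharts d ∧ Summit.FinalStateConjecture.IsFutureOriented d := by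
  sorry

/-! ## §3 The composition (kernel-checked; no `sorry` of its own) -/

section Composition

variable {X : Type} [TopologicalSpace X] [ChartedSpace E3 X] [IsManifold (𝓡 3) ∞ X] [T2Space X]
  [SecondCountableTopology X] [ConnectedSpace X]

/-- **The pointwise key.** On an admissible datum, MGHD existence (Stub 0), goodness (censored and
sub-extremally capturing) and the red-shift upgrade (Stub 4) give the crux's property: the MGHD and
complete `𝓘⁺` are handed over, and an honest `C⁰` decomposition has sub-extremal holes by goodness,
hence upgrades to an honest sub-extremal `C²` one by Stub 4. [folklore] -/
theorem cruxProperty_of_good (h₀ : Goal.stub_mghdExists) (h₄ : Goal.stub_subextremalUpgrade)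
    {D : InitialDataSet (𝓡 3) X} (hD : D ∈ admissibleVacuumData X) (hgood : IsGood D) :
    CruxProperty D := by
  refine ⟨h₀ X D hD, fun 𝒟 h𝒟 ↦ ⟨(hgood 𝒟 h𝒟).1, fun O d₀ hO hR hE hF ↦ ?_⟩⟩
  exact h₄ X D hD 𝒟 h𝒟 (hgood 𝒟 h𝒟).1 O d₀ hO hR hE hF ((hgood 𝒟 h𝒟).2 O d₀ hO hR hE hF)

/-- **A censored datum failing the crux's property sits on the extremal threshold**: given Stubs 0
and 4, if `D` is censored and not `P_G`, then some MGHD of `D` carries an honest `C⁰` final-state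
decomposition with a hole that is not sub-extremal (contrapositive of the key, negations pushed by
hand). [folklore] -/
theorem exists_extremal_of_censored_not_cruxProperty (h₀ : Goal.stub_mghdExists)
    (h₄ : Goal.stub_subextremalUpgrade) {D : InitialDataSet (𝓡 3) X}
    (hD : D ∈ admissibleVacuumData X) (hC : IsCensored D) (hbad : ¬ CruxProperty D) :
    ∃ 𝒟 : VacuumCauchyDevelopment D, 𝒟.IsMaximal ∧
      ∃ (O : Set 𝒟.carrier) (d₀ : FinalStateDecomposition 𝒟.toSpacetime O 0),
        O = Summit.FinalStateConjecture.exteriorOf 𝒟.toCauchyDevelopment d₀.charted ∧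
          Summit.FinalStateConjecture.RaysStayInClosure 𝒟.toCauchyDevelopment O ∧
            Summit.FinalStateConjecture.HasExhaustiveCharts d₀ ∧
              Summit.FinalStateConjecture.IsFutureOriented d₀ ∧
                ∃ i, ¬ Kerr.IsSubextremal (d₀.mass i) (d₀.spin i) := by
  by_contra hT
  refine hbad (cruxProperty_of_good h₀ h₄ hD fun 𝒟 h𝒟 ↦ ⟨hC 𝒟 h𝒟, fun O d₀ hO hR hE hF i ↦ ?_⟩)
  by_contra hi
  exact hT ⟨𝒟, h𝒟, O, d₀, hO, hR, hE, hF, i, hi⟩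

end Composition

/-- **THE CRUX BY NAME from the five registered stubs.** Locality of tame genericity in the parameter
(`InitialDataSet.isTameChristodoulouGeneric_of_local`, landed) reduces the crux to a locally good
tame immersed injective admissible curve through each exceptional datum `D`; case split on the
stratum of `D`: censored (then, by Stubs 0 and 4 contraposed, `D` is on the extremal threshold and
Stub 3 gives the curve) or violating (Stub 1's genericity witness is a censored curve through `D`;
Stub 2 lands off the threshold along it); Stubs 0 and 4 upgrade the good members to the crux's
property. [folklore] -/
theorem GenericCensoredCapture_of :
    Goal.stub_mghdExists → Goal.stub_weakCosmicCensorship → Goal.stub_censoredLanding →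
      Goal.stub_thresholdTransversal → Goal.stub_subextremalUpgrade → GenericCensoredCapture := by
  intro h₀ h₁ h₂ h₃ h₄ X _ _ _ _ _ _
  refine InitialDataSet.isTameChristodoulouGeneric_of_local fun D hD hbad ↦ ?_
  by_cases hC : IsCensored D
  · -- THRESHOLD stratum: `D` is censored; being exceptional, one of its MGHDs carries an honest `C⁰`
    -- final state with an exactly extremal hole (Stubs 0, 4 contraposed)
    have hT := exists_extremal_of_censored_not_cruxProperty h₀ h₄ hD hC hbad
    -- Stub 3: a locally good tame immersed injective admissible curve through `D`
    obtain ⟨e, F, hF, himm, h0, hinj, hadm, ε, hε, hgood⟩ := h₃ X D hD hC hT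
    -- Stubs 0, 4 upgrade "good" to the crux's property, member by member
    exact ⟨e, F, hF, himm, h0, hinj, hadm, ε, hε,
      fun c hc hcε ↦ cruxProperty_of_good h₀ h₄ (hadm c) (hgood c hc hcε)⟩
  · -- VIOLATING stratum: Stub 1's genericity witness is a tame immersed injective admissible curve
    -- through `D` all of whose members off `0` are censored
    obtain ⟨e, F, hF, himm, h0, hinj, hadm, hE⟩ := h₁ X D ⟨hD, hC⟩
    have hcens : ∀ c ≠ 0, IsCensored (F c) := by
      intro c hc 𝒟 h𝒟
      by_contra hI
      exact hE c hc ⟨hadm c, fun h ↦ hI (h 𝒟 h𝒟)⟩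
    subst h0
    -- the base datum has an MGHD with incomplete `𝓘⁺`
    have hV : ∃ 𝒟 : VacuumCauchyDevelopment (F 0), 𝒟.IsMaximal ∧
        ¬ Summit.FinalStateConjecture.HasCompleteNullInfinity 𝒟.toCauchyDevelopment := by
      by_contra hV
      apply hC
      intro 𝒟 h𝒟
      by_contra hI
      exact hV ⟨𝒟, h𝒟, hI⟩
    -- Stub 2: land off the threshold along the censored curve, through the same base datum
    obtain ⟨e', F', hF', himm', h0', hinj', hadm', ε, hε, hgood⟩ :=
      h₂ X e F hF himm hinj hadm hV hcens
    exact ⟨e', F', hF', himm', h0', hinj', hadm', ε, hε,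
      fun c hc hcε ↦ cruxProperty_of_good h₀ h₄ (hadm' c) (hgood c hc hcε)⟩

/-! ### Consistency: each registered stub, stated EXPANDED, IS the named statement of §1 (by `δ`). -/

theorem admissibleMGHDExistence_holds : AdmissibleMGHDExistence := stub_mghdExists
theorem tameWeakCosmicCensorship_holds : TameWeakCosmicCensorship := stub_weakCosmicCensorship
theorem censoredLanding_holds : CensoredLanding := stub_censoredLanding
theorem thresholdTransversality_holds : ThresholdTransversality := stub_thresholdTransversal
theorem subextremalRedshiftUpgrade_holds : SubextremalRedshiftUpgrade := stub_subextremalUpgrade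

/-- `AdmissibleMGHDExistence` is the route's own support item `MGHDExists`, verbatim. [folklore] -/
theorem admissibleMGHDExistence_iff_item : AdmissibleMGHDExistence ↔ MGHDExists := Iff.rfl

/-- **The crux from the skeleton** (closed modulo the five `sorry`s). [folklore] -/
theorem GenericCensoredCapture_proof : GenericCensoredCapture :=
  GenericCensoredCapture_of stub_mghdExists stub_weakCosmicCensorship stub_censoredLanding
    stub_thresholdTransversal stub_subextremalUpgrade

/-! ## §4 Logical position (no `sorry`): Stubs 1–3 assemble exactly to the sibling crux
`TameCensorshipThirdLaw` (= `GlobalAttraction.GenericCensorshipThirdLaw`), which hands each of them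
back as a weakening; the crux follows from the three GlobalAttraction items by monotonicity; and the
crux implies Stub 1. So no stub alone is the crux, and the registered cut refines an existing item. -/

/-- Stubs 1–3 ⇒ the tame censorship-third-law (locality + the two strata; no MGHD existence and no
regularity needed). [folklore] -/
theorem tameCensorshipThirdLaw_of (h₁ : Goal.stub_weakCosmicCensorship)
    (h₂ : Goal.stub_censoredLanding) (h₃ : Goal.stub_thresholdTransversal) :
    TameCensorshipThirdLaw := by
  intro X _ _ _ _ _ _
  refine InitialDataSet.isTameChristodoulouGeneric_of_local fun D hD hbad ↦ ?_
  by_cases hC : IsCensored D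
  · have hT : ∃ 𝒟 : VacuumCauchyDevelopment D, 𝒟.IsMaximal ∧
        ∃ (O : Set 𝒟.carrier) (d₀ : FinalStateDecomposition 𝒟.toSpacetime O 0),
          O = Summit.FinalStateConjecture.exteriorOf 𝒟.toCauchyDevelopment d₀.charted ∧
            Summit.FinalStateConjecture.RaysStayInClosure 𝒟.toCauchyDevelopment O ∧
              Summit.FinalStateConjecture.HasExhaustiveCharts d₀ ∧
                Summit.FinalStateConjecture.IsFutureOriented d₀ ∧
                  ∃ i, ¬ Kerr.IsSubextremal (d₀.mass i) (d₀.spin i) := by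
      by_contra hT
      refine hbad fun 𝒟 h𝒟 ↦ ⟨hC 𝒟 h𝒟, fun O d₀ hO hR hE hF i ↦ ?_⟩
      by_contra hi
      exact hT ⟨𝒟, h𝒟, O, d₀, hO, hR, hE, hF, i, hi⟩
    obtain ⟨e, F, hF, himm, h0, hinj, hadm, ε, hε, hgood⟩ := h₃ X D hD hC hT
    exact ⟨e, F, hF, himm, h0, hinj, hadm, ε, hε, hgood⟩
  · obtain ⟨e, F, hF, himm, h0, hinj, hadm, hE⟩ := h₁ X D ⟨hD, hC⟩
    have hcens : ∀ c ≠ 0, IsCensored (F c) := by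
      intro c hc 𝒟 h𝒟
      by_contra hI
      exact hE c hc ⟨hadm c, fun h ↦ hI (h 𝒟 h𝒟)⟩
    subst h0
    have hV : ∃ 𝒟 : VacuumCauchyDevelopment (F 0), 𝒟.IsMaximal ∧
        ¬ Summit.FinalStateConjecture.HasCompleteNullInfinity 𝒟.toCauchyDevelopment := by
      by_contra hV
      apply hC
      intro 𝒟 h𝒟
      by_contra hI
      exact hV ⟨𝒟, h𝒟, hI⟩
    obtain ⟨e', F', hF', himm', h0', hinj', hadm', ε, hε, hgood⟩ :=
      h₂ X e F hF himm hinj hadm hV hcens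
    exact ⟨e', F', hF', himm', h0', hinj', hadm', ε, hε, hgood⟩

/-- The crux from the three GlobalAttraction-shaped statements (MGHD existence, the tame
censorship-third-law, the sub-extremal upgrade): monotonicity of tame genericity in the property
(`IsTameChristodoulouGeneric.mono`) through the pointwise key. Records that this crux is implied by
the items stmt-9937 ∧ stmt-17297 ∧ stmt-17298 of route GlobalAttraction. [folklore] -/
theorem GenericCensoredCapture_of_thirdLaw (h₀ : Goal.stub_mghdExists) (h : TameCensorshipThirdLaw)
    (h₄ : Goal.stub_subextremalUpgrade) : GenericCensoredCapture := by
  intro X _ _ _ _ _ _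
  exact (h X).mono fun D hD hgood ↦ cruxProperty_of_good h₀ h₄ hD hgood

/-- The five stubs, factored through the sibling crux (the same theorem as `GenericCensoredCapture_of`,
second proof). [folklore] -/
theorem GenericCensoredCapture_of' (h₀ : Goal.stub_mghdExists) (h₁ : Goal.stub_weakCosmicCensorship)
    (h₂ : Goal.stub_censoredLanding) (h₃ : Goal.stub_thresholdTransversal)
    (h₄ : Goal.stub_subextremalUpgrade) : GenericCensoredCapture :=
  GenericCensoredCapture_of_thirdLaw h₀ (tameCensorshipThirdLaw_of h₁ h₂ h₃) h₄

/-- The tame censorship-third-law implies Stub 1 (forget the holes: `mono`). [folklore] -/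
theorem tameWeakCosmicCensorship_of_thirdLaw (h : TameCensorshipThirdLaw) :
    TameWeakCosmicCensorship := by
  intro X _ _ _ _ _ _
  exact (h X).mono fun D _ hgood 𝒟 h𝒟 ↦ (hgood 𝒟 h𝒟).1

/-- The tame censorship-third-law implies Stub 2 (a violating base datum is exceptional; ignore the
given curve; `ε = 1`). [folklore] -/
theorem censoredLanding_of_thirdLaw (h : TameCensorshipThirdLaw) : CensoredLanding := by
  intro X _ _ _ _ _ _ e F _ _ _ hadm hV _
  obtain ⟨𝒟₀, h𝒟₀, hI⟩ := hV
  obtain ⟨e', F', hF', himm', h0', hinj', hadm', hgood⟩ :=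
    h X (F 0) ⟨hadm 0, fun hP ↦ hI (hP 𝒟₀ h𝒟₀).1⟩
  refine ⟨e', F', hF', himm', h0', hinj', hadm', 1, one_pos, fun c hc _ ↦ ?_⟩
  by_contra hP
  exact hgood c hc ⟨hadm' c, hP⟩

/-- The tame censorship-third-law implies Stub 3 (a censored datum with an extremal honest `C⁰` final
state is exceptional; `ε = 1`). [folklore] -/
theorem thresholdTransversality_of_thirdLaw (h : TameCensorshipThirdLaw) :
    ThresholdTransversality := by
  intro X _ _ _ _ _ _ D hD _ hT
  obtain ⟨𝒟₀, h𝒟₀, O, d₀, hO, hR, hE, hF, i, hi⟩ := hT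
  obtain ⟨e, F, hF', himm, h0, hinj, hadm, hgood⟩ :=
    h X D ⟨hD, fun hP ↦ hi ((hP 𝒟₀ h𝒟₀).2 O d₀ hO hR hE hF i)⟩
  refine ⟨e, F, hF', himm, h0, hinj, hadm, 1, one_pos, fun c hc _ ↦ ?_⟩
  by_contra hP
  exact hgood c hc ⟨hadm c, hP⟩

/-- The crux implies Stub 1 (forget the holes and the upgrade: `mono`). [folklore] -/
theorem tameWeakCosmicCensorship_of_crux (h : GenericCensoredCapture) :
    TameWeakCosmicCensorship := by
  intro X _ _ _ _ _ _
  exact (h X).mono fun D _ hP 𝒟 h𝒟 ↦ (hP.2 𝒟 h𝒟).1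

end Summit.FinalStateConjecture.FinalStateConjecture.Cruxes.GenericCensoredCapture.Birth

end
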